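import Summits.Ventures.HSemireg.AmplificationChainVersalChartEGAFree
import Summits.Ventures.HSemireg.PerfectComplexSigmaLinks
import HarnessLib

/-!
# Venture HSemireg — the σ-class WITHOUT the simplicity conjunct `Hom(E,E) = ℂ` («universally GLUABLE» strictly perfect
# complexes with `(σ_q)_{q+1 ∈ I}` jointly injective) and the amplification chain ON THE SPLIT TRUST BASE for it:
# (F) ∧ (E)+(C) ⟹ the étale deformation assumption at the gluable σ-class (PROVED) ⟹ the cell-form, g = 6 and g = 4
# rows with the binder `h0 : extRank X₀ E 0 = 1` DELETED

HONEST FRAMING. Lean index of the computation cell `pub-hsemireg` (seat p7, «assembly»). Nothing about any explicit variety is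
asserted; every published input is a hypothesis BY NAME; every object and its numbers are BY VALUE; nothing here says HC, HC_CM or
HC_AV is proved; the g = 4 split case is IN PRINT ([Markman2023GeneralizedKummers] Thm. 1.5 (= Thm. 13.4; J. Eur. Math. Soc. 25
(2023) p. 236; pre-publication arXiv numbering: Thm. 1.3)) and is RE-DERIVED modulo the named hypotheses. ONE definition (an
admissibility notion — a predicate with parameters), theorems otherwise; no `sorry`, no new axiom, no Literature fact declared.
ADDITIVE: no declaration of another file is touched; target seat 7's `sigmaAdmissible` and seat p4's `rankAdmissible` are unchanged.

## Why (theory seat 3, `theory/TH3-SPLIT-COMPLEX-OBJECT-STATUS.md` v1.0 (α)(β)(δ), bus 2026-08-23T03:44:52Z)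

Every σ-row / rank-row of record quantifies over objects `E` with `Hom_{D(X₀)}(E, E) = ℂ` (`extRank X₀ E 0 = 1`: conjunct of
`sigmaAdmissible` / `rankAdmissible`, binder `h0` of every unbundled row). A SPLIT complex `E = ⊕_{i ≤ m}` of `m ≥ 2` shifted line
bundles — the widening group W4's single-height class-exact designs D11a / D11b, `E = A ⊕ B[3]` — has `dim Hom(E, E) ≥ m` and fails
exactly that conjunct, nothing else tree-side. Theory seat 3 observed that the conjunct is (α) IDLE in the kernel — this seat's split
`perfectComplexDeformsOverEtaleNbhd_sigma_of_pridhamPerfect_of_algebraisesLifts` DISCARDS it (pattern `⟨-, hneg, -, …⟩`) — and (β)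
ABSENT in print: [Pridham2024Semiregularity] Cor. 2.25 is stated for ANY perfect complex; [Lieblich2006] Thm. 4.2.1 is the stack of
UNIVERSALLY GLUABLE (`Ext^{<0} = 0`) relatively perfect complexes; [Perry2022] («universally gluable if `Ext^{<0}(E, E) = 0`»;
`𝓜(𝒞/S)` = Lieblich's stack of universally gluable objects; Prop. 8.1) and Perry's 2026 Thm. 1.1 (hypothesis: perfect with
`Ext^{<0}(E₀, E₀) = 0`, semiregular) carry no simplicity hypothesis; [BuchweitzFlenner2003] §5 / Thm. 5.1 (sheaves) neither. This file
records the kernel form of (α)+(β) ON THE SPLIT TRUST BASE, where it costs nothing: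

* §1 `gluableSigmaAdmissible` (def): target seat 7's `sigmaAdmissible` with the conjunct `extRank X₀ E 0 = 1` deleted and NOTHING
  else changed — (i) `{1, …, n} ⊆ I`; (ii) `Ext^{k}_{D(X₀)}(E, E) = 0` for `k < 0`; (iii) `E` strictly perfect in `[a, b]` with
  `(σ_q(E))_{q+1 ∈ I}` jointly injective (`HomComplex.IsISemiregularC`). `sigmaAdmissible ⟺ gluableSigmaAdmissible ∧ Hom = ℂ`.
* §2 THE SPLIT at the gluable class (PROVED, the proof of the σ-split verbatim minus one `-`):
  `PridhamPerfectLifts C → PerfectComplexAlgebraisesLifts C → PerfectComplexDeformsOverEtaleNbhd C gluableSigmaAdmissible`, its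
  rung-R2 form (object-level `PerfectLiftsAlgebraise`) and rung-R5 form (Lieblich-type versal charts, EGA IV₄ 17 KERNEL); and the
  bridge `PerfectComplexDeformsOverEtaleNbhd C gluableSigmaAdmissible → PerfectComplexDeformsOverEtaleNbhd C sigmaAdmissible` (`anti`).
* §3 ROWS WITHOUT `h0`: the cell form `(n, d, δ)` with a gluable σ-seed; the `g = 6` row UNBUNDLED (target seat 7's
  `weilSixfoldComponent_of_perfectComplexSigmaTransfer_of_complex` with `h0` deleted and `hT` replaced by the split pair) on rung R1
  and on rung R5; the `g = 4` split-hyperplane row unbundled on rung R5.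
* §4 THE SHEAF CORNER: an `I`-semiregular vector bundle `E₀`, as `E₀[0]`, is gluable-σ-admissible for `{1..n} ⊆ I` with NO
  `Hom = ℂ` hypothesis (target seat 7's `sigmaAdmissible_single₀` needs it).

TRUST-BASE STATUS (red-team caveat of theory seat 3, answered). A door assumption BY NAME at a WIDER object class is a STRONGER
assumption: `PerfectComplexDeformsOverEtaleNbhd C gluableSigmaAdmissible` implies the σ-class one (§2 `…sigma_of_gluable`), not
conversely. THIS FILE TAKES NO DOOR ASSUMPTION BY NAME AT THE GLUABLE CLASS: every row of §3 runs on the split pair — (F)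
`PridhamPerfectLifts C` (binders: a STRICTLY PERFECT `E`, no `Ext`-condition at all) and (E)+(C) `PerfectComplexAlgebraisesLifts C` /
`PerfectLiftsAlgebraise π` / `HasVersalPerfectChartAt` ∀ (binders: a bounded complex of vector bundles with `Ext^{<0}(E,E) = 0`, no
simplicity) — so the named inputs of rungs R1–R5 are LITERALLY those of the σ-rows of record (`AmplificationChainPridhamPerfect.lean`,
`AmplificationChainG4SigmaLadder.lean`, theory seat 3's `AmplificationChainVersalChart*.lean`), and the kernel certifies that they
already cover gluable non-simple objects. What the cell DOES with non-simple row objects (tier words, census rows) is the table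
owners' call (theory seat 3 (δ)); nothing here files a row.

NOT here: any object, any σ-rank, any class-exactness claim (W4's D11a/b are class-level lattice points until their `σ_diag` rank
is certified ×2); the `…_of_local_ff_single` Monday shapes (their `Ext` binders are transported from a source SHEAF along a local
fully faithful functor — meaningless for a split complex, whose `Ext^{<0}` is read off directly); a rung-R0 row at the gluable class
(it would be a NEW by-name assumption, stronger than theory seat 3's); re-typing of `sigmaAdmissible` / `rankAdmissible` (owners:
target seat 7 / seat p4); HC_CM, CM density, Mumford–Tate finiteness.

References: [Lieblich2006] J. Algebraic Geom. 15 (2006), Thm. 4.2.1, Prop. 2.1.9 (universally gluable) · [Perry2022] Compositio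
Math. 158 (2022), Prop. 8.1 and its proof (𝓜(𝒞/S) via [Lie06]; «universally gluable if Ext^{<0}(E,E) = 0») ·
[Pridham2024Semiregularity] Forum Math. Sigma 12 (2024) e126, Cor. 2.25, Rem. 2.27, Rem. 2.21, Lemma 1.8–1.9 · [BuchweitzFlenner2003]
Def. 4.1, §5 · [EGAIV4] Prop. 17.14.2, Cor. 17.16.3 (i) · [Deligne1982HodgeCycles] proof of Thm. 4.8 · [Markman2023GeneralizedKummers]
JEMS 25 (2023) Thm. 1.5 (= Thm. 13.4), p. 236 (pre-publication arXiv numbering: Thm. 1.3).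
-/

noncomputable section

open CategoryTheory CategoryTheory.Limits AlgebraicGeometry
open Literature.AlgebraicGeometry Literature.AlgebraicGeometry.Motives Literature.AlgebraicGeometry.Modules
open Literature.AlgebraicGeometry.HodgeTheory Literature.AlgebraicGeometry.KTheory
open Literature.AlgebraicGeometry.ModuliOfAbelianVarieties Literature.AlgebraicGeometry.Deligne1982
open Literature.AlgebraicGeometry.VanGeemen1994
open Literature.AlgebraicTopology.SingularHomology

namespace Summit.Ventures.HSemireg

open Summit.HodgeConjecture.HodgeConjecture
open Summit.HodgeConjecture.HodgeConjecture.WeilTypeLadder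
open Summit.HodgeConjecture.HodgeConjecture.Cruxes.HodgeAbelianVarieties.EStepSecantInduction
open Summit.HodgeConjecture.HodgeConjecture.Ring2.Hypotheses
open Summit.HodgeConjecture.HodgeConjecture.Ring2.AbelianAll

/-! ## §1 The gluable σ-class: `sigmaAdmissible` minus `Hom(E,E) = ℂ` -/

section Notion

/-- **The GLUABLE σ-admissibility notion** (PREDICATE; target seat 7's `sigmaAdmissible` with the simplicity conjunct
`extRank X₀ E 0 = 1` DELETED, nothing else changed): (i) `{1, …, n} ⊆ I`; (ii) `Ext^{k}_{D(X₀)}(E, E) = 0` for `k < 0` (`extRank`,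
seat p4 — Lieblich's «universally gluable», Perry's «universally gluable if `Ext^{<0}(E,E) = 0`»); (iii) `E` is concentrated in
degrees `[a, b]` with every term finite locally free and `(σ_q(E))_{q+1 ∈ I}` JOINTLY INJECTIVE on `Ext²(E,E)`
(`HomComplex.IsISemiregularC`, the cell's real `σ_q`, in `D(Mod 𝒪_{X₀})` for `HasDerivedCategory.standard`). A split complex
`⊕ L_i[n_i]` of `m ≥ 2` shifted line bundles can satisfy this notion (never `sigmaAdmissible`: `dim Hom ≥ m`). In print NO source of the
chain assumes simplicity: [Lieblich2006] Thm. 4.2.1 (gluable), [Pridham2024Semiregularity] Cor. 2.25 (any perfect complex),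
[Perry2022] Prop. 8.1 (Lieblich's stack of universally gluable objects), [BuchweitzFlenner2003] §5.
[cite: Lieblich2006, Thm. 4.2.1 and Prop. 2.1.9 (universally gluable)] [cite: Perry2022, Prop. 8.1 (𝓜(𝒞/S): universally gluable objects)]
[cite: BuchweitzFlenner2003, Def. 4.1 and §5 (I-semiregular)] [cite: Pridham2024Semiregularity, Cor. 2.25 (any perfect complex)] -/
def gluableSigmaAdmissible : AdmissibilityNotion := fun n X₀ I E =>
  (∀ p : ℕ, 1 ≤ p → p ≤ n → p ∈ I) ∧
    (∀ k : ℤ, k < 0 → extRank X₀ E k = 0) ∧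
      ∃ (a b : ℤ) (_ : E.IsStrictlyGE a) (_ : E.IsStrictlyLE b) (hE : ∀ i, IsFiniteLocallyFree (E.X i)),
        letI := HasDerivedCategory.standard X₀.left.Modules
        HomComplex.IsISemiregularC X₀ E a b hE {q | q + 1 ∈ I}

variable {n : ℕ} {X₀ : SchemeOver ℂ} {I : Finset ℕ} {E : CochainComplex X₀.left.Modules ℤ}

/-- A σ-admissible complex is gluable-σ-admissible (drop `Hom = ℂ`). [cite: BuchweitzFlenner2003, §5 (I-semiregular)] -/
theorem gluableSigmaAdmissible_of_sigmaAdmissible (h : sigmaAdmissible n X₀ I E) : gluableSigmaAdmissible n X₀ I E :=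
  ⟨h.1, h.2.1, h.2.2.2⟩

/-- A gluable-σ-admissible complex with `Hom(E,E) = ℂ` is σ-admissible. [cite: BuchweitzFlenner2003, §5 (I-semiregular)] -/
theorem sigmaAdmissible_of_gluable_of_extRank_zero (h : gluableSigmaAdmissible n X₀ I E) (h0 : extRank X₀ E 0 = 1) :
    sigmaAdmissible n X₀ I E :=
  ⟨h.1, h.2.1, h0, h.2.2⟩

/-- **`sigmaAdmissible ⟺ gluableSigmaAdmissible ∧ Hom(E,E) = ℂ`** — the notion of §1 is target seat 7's minus exactly one conjunct.
[cite: BuchweitzFlenner2003, §5 (I-semiregular)] -/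
theorem sigmaAdmissible_iff_gluable_and_extRank_zero :
    sigmaAdmissible n X₀ I E ↔ gluableSigmaAdmissible n X₀ I E ∧ extRank X₀ E 0 = 1 :=
  ⟨fun h => ⟨gluableSigmaAdmissible_of_sigmaAdmissible h, h.2.2.1⟩,
    fun h => sigmaAdmissible_of_gluable_of_extRank_zero h.1 h.2⟩

/-- The object classes: every σ-seed family of classes is a gluable-σ family of classes. [folklore] -/
theorem perfectObjClass_gluable_of_sigma (C : ChernCharacterBetti) {κ : ∀ p : ℕ, complexBetti X₀ (2 * p)}
    (h : sigmaObjClass C n X₀ I κ) : perfectObjClass C gluableSigmaAdmissible n X₀ I κ :=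
  h.mono fun _ _ _ _ => gluableSigmaAdmissible_of_sigmaAdmissible

end Notion

/-! ## §2 The split at the gluable class: (F) ∧ (E)+(C) ⟹ the étale deformation assumption (PROVED), rungs R1 / R2 / R5 -/

section Split

variable {C : ChernCharacterBetti}

/-- **`PridhamPerfectLifts C ∧ PerfectComplexAlgebraisesLifts C ⟹ PerfectComplexDeformsOverEtaleNbhd C gluableSigmaAdmissible`**
(PROVED; rung R1). Verbatim the proof of `perfectComplexDeformsOverEtaleNbhd_sigma_of_pridhamPerfect_of_algebraisesLifts`: (F) consumes
the strictly perfect structure, the joint injectivity of `(σ_q)_{q+1 ∈ I}` and the Hodge hypothesis and returns the derived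
small-extension lifting property; (E)+(C) consumes `Ext^{<0} = 0` and returns the étale deformation with the right classes. Simplicity
was never consumed, so nothing is lost by not assuming it. [cite: Pridham2024Semiregularity, Cor. 2.25; Rem. 2.27; Lemma 1.8–1.9]
[cite: Perry2022, proof of Prop. 8.1] [cite: Lieblich2006, Thm. 4.2.1] -/
theorem perfectComplexDeformsOverEtaleNbhd_gluable_of_pridhamPerfect_of_algebraisesLifts (hP : PridhamPerfectLifts C)
    (hA : PerfectComplexAlgebraisesLifts C) : PerfectComplexDeformsOverEtaleNbhd C gluableSigmaAdmissible := by
  intro 𝒳 S π n hπ hS U hU s₀ X₀ e κ I hobj hHodge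
  obtain ⟨E, hEb, ⟨-, hneg, a, b, hGE, hLE, hE, hσ⟩, hκ⟩ := hobj
  have hHodge' : ∀ p ∈ I, ∀ (t : U) (γ : Path.Homotopic.Quotient s₀ t),
      IsOfHodgeType n (fiberOver π t.1) (2 * p) p p
        (transportFun π (2 * p) hU γ (complexBetti.map e.inv (2 * p) (chPerfect C X₀ E hE p))) := fun p hp t γ => by
    have h := hHodge p hp t γ
    rw [hκ p hp] at h
    exact h
  -- (F): the printed statement gives the derived lifting property; (E)+(C): the Hodge-free assumption algebraises it
  obtain ⟨T, ρ, hρ, t₀, ht₀, ℰ, hℰ, hch⟩ :=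
    hA π n hπ hS s₀.1 X₀ e E hEb hneg (hP π n hπ hS hU s₀ X₀ e E a b hGE hLE hE I hσ hHodge')
  refine ⟨T, ρ, hρ, t₀, ht₀, ℰ, hℰ, fun p hp => ?_⟩
  rw [hκ p hp]
  exact hch p

/-- **Bridge (the red-team caveat in kernel form)**: the étale deformation assumption at the GLUABLE class implies the one at the
σ-class (`anti` along `sigmaAdmissible ⟹ gluableSigmaAdmissible`) — BY NAME the gluable-class door would be the STRONGER assumption;
this file never takes it by name (it is DERIVED, above). In particular the σ-split of `AmplificationChainPridhamPerfect.lean` is a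
corollary of the gluable split. [cite: Perry2022, proof of Prop. 8.1] -/
theorem PerfectComplexDeformsOverEtaleNbhd.sigma_of_gluable (hD : PerfectComplexDeformsOverEtaleNbhd C gluableSigmaAdmissible) :
    PerfectComplexDeformsOverEtaleNbhd C sigmaAdmissible :=
  hD.anti fun _ _ _ _ => gluableSigmaAdmissible_of_sigmaAdmissible

/-- **Rung R2 at the gluable class**: (F) ∧ the OBJECT-LEVEL `PerfectLiftsAlgebraise π` for every smooth projective `π` over a smooth
base (theory seat 3, `AmplificationChainEtaleFamily.lean`; its binder is «bounded complex of vector bundles with `Ext^{<0} = 0`», no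
simplicity) ⟹ the étale deformation assumption at the gluable class. [cite: Perry2022, proof of Prop. 8.1] [cite: Lieblich2006, Thm. 4.2.1] -/
theorem perfectComplexDeformsOverEtaleNbhd_gluable_of_pridhamPerfect_of_perfectLiftsAlgebraise (hP : PridhamPerfectLifts C)
    (hA : ∀ ⦃𝒳 S : SchemeOver ℂ⦄ (π : 𝒳 ⟶ S) (n : ℕ),
      IsSmoothProjectiveFamily π n → _root_.AlgebraicGeometry.Smooth S.hom → PerfectLiftsAlgebraise π) :
    PerfectComplexDeformsOverEtaleNbhd C gluableSigmaAdmissible :=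
  perfectComplexDeformsOverEtaleNbhd_gluable_of_pridhamPerfect_of_algebraisesLifts hP
    (perfectComplexAlgebraisesLifts_of_perfectLiftsAlgebraise hA C)

/-- **Rung R5 at the gluable class**: (F) ∧ Lieblich-type versal charts (`HasVersalPerfectChartAt` for every bounded complex of vector
bundles with `Ext^{<0} = 0` on every smooth projective family over a smooth base — versality in EXISTENCE form, weaker than
[Lieblich2006]'s formal smoothness; assumption BY NAME; no simplicity in its binder) ⟹ the étale deformation assumption at the gluable
class; EGA IV₄ (17.14.2)/(17.16.3)(i) and theory seat 3's glue are KERNEL (`perfectComplexAlgebraisesLifts_of_versalCharts`).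
[cite: Lieblich2006, Thm. 4.2.1] [cite: EGAIV4, Prop. 17.14.2 and Cor. 17.16.3 (i)] [cite: Perry2022, proof of Prop. 8.1] -/
theorem perfectComplexDeformsOverEtaleNbhd_gluable_of_pridhamPerfect_of_versalCharts (hP : PridhamPerfectLifts C)
    (hV : ∀ ⦃𝒳 S : SchemeOver ℂ⦄ (π : 𝒳 ⟶ S) (n : ℕ),
      IsSmoothProjectiveFamily π n → _root_.AlgebraicGeometry.Smooth S.hom →
      ∀ (s₀ : ComplexPoints S) (X₀ : SchemeOver ℂ) (e : X₀ ≅ fiberOver π s₀)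
        (E : CochainComplex X₀.left.Modules ℤ), IsBoundedVBComplex E →
        (∀ k : ℤ, k < 0 → extRank X₀ E k = 0) → HasVersalPerfectChartAt π s₀ X₀ e E) :
    PerfectComplexDeformsOverEtaleNbhd C gluableSigmaAdmissible :=
  perfectComplexDeformsOverEtaleNbhd_gluable_of_pridhamPerfect_of_algebraisesLifts hP
    (perfectComplexAlgebraisesLifts_of_versalCharts hV C)

/-- **The split pair IS a local variational Hodge statement for the gluable σ-class** (door-agnostic currency of the assembly; every
`LocalVariationalHodgeFor`-consumer — the Weil-anchor chain, the `𝒜_g` / Hodge-locus-component chain `AmplificationChainSiegel.lean`, the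
cell forms of `ComponentCellsRouteC.lean` — instantiates at the gluable class by dot notation).
[cite: Pridham2024Semiregularity, Cor. 2.25; Rem. 2.27] [cite: Perry2022, proof of Prop. 8.1] [cite: BuchweitzFlenner2003, §5, proof of Thm. 5.1] -/
theorem localVariationalHodgeFor_gluable_of_pridhamPerfect_of_algebraisesLifts (hP : PridhamPerfectLifts C)
    (hA : PerfectComplexAlgebraisesLifts C) : LocalVariationalHodgeFor (perfectObjClass C gluableSigmaAdmissible) :=
  (perfectComplexDeformsOverEtaleNbhd_gluable_of_pridhamPerfect_of_algebraisesLifts hP hA).localVariationalHodgeFor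

end Split

/-! ## §3 Rows WITHOUT `h0`, on the split trust base -/

section CellForm

variable {C : ChernCharacterBetti}

/-- **Cell form `(n, d, δ)`, gluable σ-seed, rung R1.** BY NAME: `weilFamilyReach_similar` (Deligne's reach by similitudes, REFEREED tree
fact), (F) `PridhamPerfectLifts C` (printed + refereed statement typed venture-side on the real `σ`-carrier; hypothesis by name),
(E)+(C) `PerfectComplexAlgebraisesLifts C` (Hodge-free; kernel-linked to nothing). BY VALUE: a polarized Weil-type `(n, d)` member
`(P, ψ₀, h_K)` of the cell `δ` with its Gram placement, a non-zero rational Weil class `w`, and ONE seed of class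
`perfectObjClass C gluableSigmaAdmissible` on it (`HasSeedOn`: `{1..2n} ⊆ I ∋ n`, a bounded complex of vector bundles `E` with
`Ext^{<0}(E,E) = 0` — NO `Hom = ℂ` — and `(σ_q(E))_{q+1 ∈ I}` jointly injective, `ch_n(E) = q·h_Kⁿ + w`, `ch_p(E) = c_p·h_Kᵖ` off `n`).
Conclusion: `WeilClassesComponent n d δ`. Nothing asserted; no census row supplies such a seed on a deciding component.
[cite: Deligne1982HodgeCycles, proof of Thm. 4.8] [cite: Pridham2024Semiregularity, Cor. 2.25; Rem. 2.27] [cite: Perry2022, proof of Prop. 8.1]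
[cite: Lieblich2006, Thm. 4.2.1] [cite: BuchweitzFlenner2003, Def. 4.1 and §5 (I-semiregular)] -/
theorem weilClassesComponent_of_reachSimilar_of_pridhamPerfect_of_algebraisesLifts_of_gluableSeedOn_member {n d : ℕ}
    {δ : weilNormResidueGroup d} (hF : weilFamilyReach_similar) (hP : PridhamPerfectLifts C)
    (hA : PerfectComplexAlgebraisesLifts C)
    {P : AbelianVariety ℂ} {ψ₀ : P ⟶ P} (hW : IsWeilType P ψ₀ n d) (e : ProjectiveEmbedding P.X)
    {a : complexBetti (projectiveSpace e.n ℂ) 2} (haQ : IsRationalClass a) (ha0 : a ≠ 0)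
    (hδ : HasWeilDiscriminantNondeg P ψ₀ n d (symmetrisedClass d P ψ₀ e a) δ)
    {w : complexBetti P.X (2 * n)} (hwW : w ∈ weilClassesOf P ψ₀ n d) (hwQ : IsRationalClass w) (hw0 : w ≠ 0)
    (hS : HasSeedOn (perfectObjClass C gluableSigmaAdmissible) n P (symmetrisedClass d P ψ₀ e a) w) :
    WeilClassesComponent n d δ :=
  weilClassesComponent_of_localVariationalHodgeFor_of_seedOn_member hF
    (localVariationalHodgeFor_gluable_of_pridhamPerfect_of_algebraisesLifts hP hA) hW e haQ ha0 hδ hwW hwQ hw0 hS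

end CellForm

section SixUnbundled

variable {C : ChernCharacterBetti}

/-- **`g = 6`, route (C), σ-tier, the row UNBUNDLED WITHOUT `h0`, rung R1** — target seat 7's
`weilSixfoldComponent_of_perfectComplexSigmaTransfer_of_complex` with the binder `h0 : extRank P.X E 0 = 1` DELETED and the by-name
transfer `hT` REPLACED by the split pair. BY NAME: `weilFamilyReach_similar` (REFEREED), (F) `PridhamPerfectLifts C`, (E)+(C)
`PerfectComplexAlgebraisesLifts C`. BY VALUE: a Weil-type `(3, d)` member `(P, ψ₀)` of the sixfold cell `δ` with projective embedding
`e`, rational `a ≠ 0`, Gram placement `hδ`; a non-zero rational class `w` of its Weil plane; `I ⊇ {1, …, 6}`; ONE cochain complex `E` of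
`𝒪_P`-modules, a bounded complex of vector bundles concentrated in `[a', b']`, with `Ext^k_{D(P)}(E, E) = 0` for `k < 0` and
`(σ_q(E))_{q+1 ∈ I}` JOINTLY INJECTIVE (`HomComplex.IsISemiregularC`, by value — a census certificate «σ-rank = dim Ext² on two
codes»; no computation discharges it in the kernel); rationals `q`, `c_p` with `ch₃(E) = q·h_K³ + w`, `ch_p(E) = c_p·h_Kᵖ` for
`p ∈ I ∖ {3}`. `Hom(E, E)` is UNCONSTRAINED (split complexes allowed). Conclusion: `WeilClassesComponent 3 d δ`. Nothing asserted; no row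
of the census supplies these binders on a deciding component. [cite: Deligne1982HodgeCycles, proof of Thm. 4.8]
[cite: Pridham2024Semiregularity, Cor. 2.25; Rem. 2.27; Rem. 2.21; Lemma 1.8–1.9] [cite: Perry2022, proof of Prop. 8.1]
[cite: Lieblich2006, Thm. 4.2.1] [cite: BuchweitzFlenner2003, Def. 4.1 and §5 (I-semiregular)] -/
theorem weilSixfoldComponent_of_reachSimilar_of_pridhamPerfect_of_algebraisesLifts_of_gluableComplex {d : ℕ}
    {δ : weilNormResidueGroup d} (hF : weilFamilyReach_similar) (hP : PridhamPerfectLifts C)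
    (hA : PerfectComplexAlgebraisesLifts C)
    {P : AbelianVariety ℂ} {ψ₀ : P ⟶ P} (hW : IsWeilType P ψ₀ 3 d) (e : ProjectiveEmbedding P.X)
    {a : complexBetti (projectiveSpace e.n ℂ) 2} (haQ : IsRationalClass a) (ha0 : a ≠ 0)
    (hδ : HasWeilDiscriminantNondeg P ψ₀ 3 d (symmetrisedClass d P ψ₀ e a) δ)
    {w : complexBetti P.X 6} (hwW : w ∈ weilClassesOf P ψ₀ 3 d) (hwQ : IsRationalClass w) (hw0 : w ≠ 0)
    (I : Finset ℕ) (hI : ∀ p : ℕ, 1 ≤ p → p ≤ 2 * 3 → p ∈ I) (E : CochainComplex P.X.left.Modules ℤ)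
    (hE : IsBoundedVBComplex E) (hneg : ∀ k : ℤ, k < 0 → extRank P.X E k = 0)
    (a' b' : ℤ) [E.IsStrictlyGE a'] [E.IsStrictlyLE b']
    (hσ : letI := HasDerivedCategory.standard P.X.left.Modules
      HomComplex.IsISemiregularC P.X E a' b' hE.isFiniteLocallyFree {q | q + 1 ∈ I})
    (q : ℚ) (c : ℕ → ℚ)
    (hch3 : chPerfect C P.X E hE.isFiniteLocallyFree 3 = ((q : ℚ) : ℂ) • cupPowTwo (symmetrisedClass d P ψ₀ e a) 3 + w)
    (hchp : ∀ p ∈ I, p ≠ 3 →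
      chPerfect C P.X E hE.isFiniteLocallyFree p = ((c p : ℚ) : ℂ) • cupPowTwo (symmetrisedClass d P ψ₀ e a) p) :
    WeilClassesComponent 3 d δ :=
  weilClassesComponent_of_reachSimilar_of_pridhamPerfect_of_algebraisesLifts_of_gluableSeedOn_member hF hP hA hW e haQ ha0
    hδ hwW hwQ hw0
    ⟨I, fun p => chPerfect C P.X E hE.isFiniteLocallyFree p, q, c, hI 3 (by norm_num) (by norm_num),
      ⟨E, hE, ⟨hI, hneg, a', b', inferInstance, inferInstance, hE.isFiniteLocallyFree, hσ⟩, fun _ _ => rfl⟩, hch3, hchp⟩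

/-- **`g = 6`, route (C), σ-tier, the row UNBUNDLED WITHOUT `h0`, rung R5 — the finest split trust base of record.** BY NAME:
`weilFamilyReach_similar` (REFEREED), (F) `PridhamPerfectLifts C` (printed + refereed statement, venture-typed; hypothesis by name),
Lieblich-type versal charts (`HasVersalPerfectChartAt` for every bounded complex of vector bundles with `Ext^{<0} = 0` on every smooth
projective family over a smooth base — versality in EXISTENCE form, weaker than [Lieblich2006]'s formal smoothness; assumption by name);
EGA IV₄ (17.14.2)/(17.16.3)(i) KERNEL. BY VALUE: verbatim the rung-R1 row above (`Hom(E,E)` unconstrained). Conclusion: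
`WeilClassesComponent 3 d δ`. Nothing asserted. [cite: Deligne1982HodgeCycles, proof of Thm. 4.8]
[cite: Pridham2024Semiregularity, Cor. 2.25; Rem. 2.27] [cite: Lieblich2006, Thm. 4.2.1] [cite: EGAIV4, Prop. 17.14.2 and Cor. 17.16.3 (i)]
[cite: BuchweitzFlenner2003, Def. 4.1 and §5 (I-semiregular)] -/
theorem weilSixfoldComponent_of_reachSimilar_of_pridhamPerfect_of_versalCharts_of_gluableComplex {d : ℕ}
    {δ : weilNormResidueGroup d} (hF : weilFamilyReach_similar) (hP : PridhamPerfectLifts C)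
    (hV : ∀ ⦃𝒳 S : SchemeOver ℂ⦄ (π : 𝒳 ⟶ S) (n : ℕ),
      IsSmoothProjectiveFamily π n → _root_.AlgebraicGeometry.Smooth S.hom →
      ∀ (s₀ : ComplexPoints S) (X₀ : SchemeOver ℂ) (e : X₀ ≅ fiberOver π s₀)
        (E : CochainComplex X₀.left.Modules ℤ), IsBoundedVBComplex E →
        (∀ k : ℤ, k < 0 → extRank X₀ E k = 0) → HasVersalPerfectChartAt π s₀ X₀ e E)
    {P : AbelianVariety ℂ} {ψ₀ : P ⟶ P} (hW : IsWeilType P ψ₀ 3 d) (e : ProjectiveEmbedding P.X)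
    {a : complexBetti (projectiveSpace e.n ℂ) 2} (haQ : IsRationalClass a) (ha0 : a ≠ 0)
    (hδ : HasWeilDiscriminantNondeg P ψ₀ 3 d (symmetrisedClass d P ψ₀ e a) δ)
    {w : complexBetti P.X 6} (hwW : w ∈ weilClassesOf P ψ₀ 3 d) (hwQ : IsRationalClass w) (hw0 : w ≠ 0)
    (I : Finset ℕ) (hI : ∀ p : ℕ, 1 ≤ p → p ≤ 2 * 3 → p ∈ I) (E : CochainComplex P.X.left.Modules ℤ)
    (hE : IsBoundedVBComplex E) (hneg : ∀ k : ℤ, k < 0 → extRank P.X E k = 0)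
    (a' b' : ℤ) [E.IsStrictlyGE a'] [E.IsStrictlyLE b']
    (hσ : letI := HasDerivedCategory.standard P.X.left.Modules
      HomComplex.IsISemiregularC P.X E a' b' hE.isFiniteLocallyFree {q | q + 1 ∈ I})
    (q : ℚ) (c : ℕ → ℚ)
    (hch3 : chPerfect C P.X E hE.isFiniteLocallyFree 3 = ((q : ℚ) : ℂ) • cupPowTwo (symmetrisedClass d P ψ₀ e a) 3 + w)
    (hchp : ∀ p ∈ I, p ≠ 3 →
      chPerfect C P.X E hE.isFiniteLocallyFree p = ((c p : ℚ) : ℂ) • cupPowTwo (symmetrisedClass d P ψ₀ e a) p) :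
    WeilClassesComponent 3 d δ :=
  weilSixfoldComponent_of_reachSimilar_of_pridhamPerfect_of_algebraisesLifts_of_gluableComplex hF hP
    (perfectComplexAlgebraisesLifts_of_versalCharts hV C) hW e haQ ha0 hδ hwW hwQ hw0 I hI E hE hneg a' b' hσ q c hch3 hchp

end SixUnbundled

section FourUnbundled

variable {C : ChernCharacterBetti}

/-- **`g = 4`, route (C), σ-tier, the split-hyperplane row UNBUNDLED WITHOUT `h0`, rung R5.** BY NAME: `weilFamilyReach_hyperbolic`
(Deligne, REFEREED), (F) `PridhamPerfectLifts C`, Lieblich-type versal charts (as above); EGA IV₄ 17 KERNEL. BY VALUE: verbatim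
`weilFourfoldsSplit_of_reach_of_pridhamPerfect_of_versalCharts_of_complex` (theory seat 3) minus `h0` — the split CM anchor
`(P, ψ₀, e, a)` and hyperbolicity, `w ≠ 0` rational in the Weil plane, `I ⊇ {1..4}`, ONE bounded complex of vector bundles `E` in
`[a', b']` with `Ext^{<0}(E,E) = 0` and `(σ_q(E))_{q+1 ∈ I}` jointly injective, `ch₂(E) = q·h_K² + w`, `ch_p(E) = c_p·h_Kᵖ` off `2`;
`Hom(E,E)` unconstrained. Conclusion: `Stubs.WeilAlgebraicSplitHyperplane 2 d` (in print: [Markman2023GeneralizedKummers] Thm. 1.5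
(= Thm. 13.4; J. Eur. Math. Soc. 25 (2023) p. 236; pre-publication arXiv numbering: Thm. 1.3); re-derived, no new case).
[cite: Markman2023GeneralizedKummers, Theorem 1.5 (= Theorem 13.4), p. 236 (the case in print; arXiv:1805.11574 pre-publication numbering: Theorem 1.3)]
[cite: Pridham2024Semiregularity, Cor. 2.25; Rem. 2.27] [cite: Lieblich2006, Thm. 4.2.1] [cite: EGAIV4, Prop. 17.14.2 and Cor. 17.16.3 (i)]
[cite: Deligne1982HodgeCycles, proof of Thm. 4.8] -/
theorem weilFourfoldsSplit_of_reach_of_pridhamPerfect_of_versalCharts_of_gluableComplex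
    (hF : weilFamilyReach_hyperbolic) (hP : PridhamPerfectLifts C)
    (hV : ∀ ⦃𝒳 S : SchemeOver ℂ⦄ (π : 𝒳 ⟶ S) (n : ℕ),
      IsSmoothProjectiveFamily π n → _root_.AlgebraicGeometry.Smooth S.hom →
      ∀ (s₀ : ComplexPoints S) (X₀ : SchemeOver ℂ) (e : X₀ ≅ fiberOver π s₀)
        (E : CochainComplex X₀.left.Modules ℤ), IsBoundedVBComplex E →
        (∀ k : ℤ, k < 0 → extRank X₀ E k = 0) → HasVersalPerfectChartAt π s₀ X₀ e E)
    {d : ℕ} (hd : 0 < d)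
    (P : AbelianVariety ℂ) (ψ₀ : P ⟶ P) (e : ProjectiveEmbedding P.X) (a : complexBetti (projectiveSpace e.n ℂ) 2)
    (hP4 : P.dim = 2 * 2) (hψ : ψ₀ ≫ ψ₀ = -(d • 𝟙 P)) (ha : IsRationalClass a) (ha0 : a ≠ 0)
    (hhyp : IsHyperbolicWeilType P ψ₀ 2 (symmetrisedClass d P ψ₀ e a))
    (w : complexBetti P.X (2 * 2)) (hwW : w ∈ weilClassesOf P ψ₀ 2 d) (hwr : IsRationalClass w) (hw0 : w ≠ 0)
    (I : Finset ℕ) (hI : ∀ p : ℕ, 1 ≤ p → p ≤ 2 * 2 → p ∈ I) (E : CochainComplex P.X.left.Modules ℤ)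
    (hE : IsBoundedVBComplex E) (hneg : ∀ k : ℤ, k < 0 → extRank P.X E k = 0)
    (a' b' : ℤ) [E.IsStrictlyGE a'] [E.IsStrictlyLE b']
    (hσ : letI := HasDerivedCategory.standard P.X.left.Modules
      HomComplex.IsISemiregularC P.X E a' b' hE.isFiniteLocallyFree {q | q + 1 ∈ I})
    (q : ℚ) (c : ℕ → ℚ)
    (hch2 : chPerfect C P.X E hE.isFiniteLocallyFree 2 = ((q : ℚ) : ℂ) • cupPowTwo (symmetrisedClass d P ψ₀ e a) 2 + w)
    (hchp : ∀ p ∈ I, p ≠ 2 →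
      chPerfect C P.X E hE.isFiniteLocallyFree p = ((c p : ℚ) : ℂ) • cupPowTwo (symmetrisedClass d P ψ₀ e a) p) :
    Stubs.WeilAlgebraicSplitHyperplane 2 d :=
  weilFourfoldsSplit_of_reach_of_deformsOverEtaleNbhd_of_complex hF
    (perfectComplexDeformsOverEtaleNbhd_gluable_of_pridhamPerfect_of_versalCharts hP hV) hd P ψ₀ e a hP4 hψ ha ha0 hhyp w
    hwW hwr hw0 I (hI 2 (by norm_num) (by norm_num)) E hE
    ⟨hI, hneg, a', b', inferInstance, inferInstance, hE.isFiniteLocallyFree, hσ⟩ q c hch2 hchp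

end FourUnbundled

/-! ## §4 The sheaf corner: `E₀[0]` is gluable-σ-admissible with NO `Hom = ℂ` hypothesis -/

section Sheaf

variable {n : ℕ} {X₀ : SchemeOver ℂ} {I : Finset ℕ}

/-- **An `I`-semiregular vector bundle, as the complex `E₀[0]`, is gluable-σ-admissible** for `{1..n} ⊆ I` — WITHOUT the hypothesis
`Hom(E₀, E₀) = ℂ` that target seat 7's `sigmaAdmissible_single₀` needs: `Ext^{<0}(E₀[0], E₀[0]) = 0` is p6's
`extRank_single_neg_eq_zero` (a sheaf has no negative self-extensions, [Lieblich2006] Prop. 2.1.9) and `IsISemiregularC` of `E₀[0]` is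
the module-level `IsISemiregular` by the K2 anchor `HomComplex.isISemiregularC_single₀_iff`. So every `I`-semiregular sheaf of BF's
door with `{1..n} ⊆ I` — simple or not — is an object of the gluable σ-class.
[cite: BuchweitzFlenner2003, §5 (I-semiregular)] [cite: Lieblich2006, Prop. 2.1.9] -/
theorem gluableSigmaAdmissible_single₀ (E₀ : X₀.left.Modules) (hE₀ : IsFiniteLocallyFree E₀)
    (hI : ∀ p : ℕ, 1 ≤ p → p ≤ n → p ∈ I) (hsr : IsISemiregular hE₀ {q | q + 1 ∈ I}) :
    gluableSigmaAdmissible n X₀ I (HomComplex.single₀ X₀.left E₀) := by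
  letI := HasDerivedCategory.standard X₀.left.Modules
  have hK : ∀ p, IsFiniteLocallyFree ((HomComplex.single₀ X₀.left E₀).X p) :=
    (IsBoundedVBComplex.single E₀ hE₀ 0).isFiniteLocallyFree
  exact ⟨hI, fun k hk => extRank_single_neg_eq_zero E₀ hk, 0, 0, inferInstance, inferInstance, hK,
    (HomComplex.isISemiregularC_single₀_iff X₀ E₀ hE₀ hK _).2 hsr⟩

/-- **The Chern character of an `I`-semiregular vector bundle (`{1..n} ⊆ I`, no simplicity) is in the gluable σ-class**
(`κ_p = C.ch_p E₀ = ch_p(E₀[0])`, `chPerfect_single`). [cite: BuchweitzFlenner2003, §5 (I-semiregular)] [cite: Fulton1998, Example 3.2.3] -/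
theorem perfectObjClass_gluable_single₀ (C : ChernCharacterBetti) (E₀ : X₀.left.Modules) (hE₀ : IsFiniteLocallyFree E₀)
    (hI : ∀ p : ℕ, 1 ≤ p → p ≤ n → p ∈ I) (hsr : IsISemiregular hE₀ {q | q + 1 ∈ I}) :
    perfectObjClass C gluableSigmaAdmissible n X₀ I (fun p => C.ch X₀ E₀ p) :=
  ⟨HomComplex.single₀ X₀.left E₀, IsBoundedVBComplex.single E₀ hE₀ 0, gluableSigmaAdmissible_single₀ E₀ hE₀ hI hsr,
    fun p _ => (chPerfect_single C X₀ E₀ hE₀ (IsBoundedVBComplex.single E₀ hE₀ 0).isFiniteLocallyFree p).symm⟩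

end Sheaf

/-! ## Audit: what is assumed, what is proved
ASSUMED BY NAME in §3: `weilFamilyReach_similar` / `weilFamilyReach_hyperbolic` (refereed), `PridhamPerfectLifts C` (printed +
refereed statement, venture-typed over a real carrier, undischarged), and EITHER `PerfectComplexAlgebraisesLifts C` (rung R1; Hodge-free,
kernel-linked to nothing) OR Lieblich-type versal charts `HasVersalPerfectChartAt` ∀ (rung R5; assumption by name) — LITERALLY the named
inputs of the σ-rows of record; the objects BY VALUE, with `Hom(E,E)` unconstrained. PROVED: §1 (`sigmaAdmissible ⟺ gluable ∧ Hom = ℂ`),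
§2 (the split at the gluable class, rungs R1/R2/R5; the bridge gluable-door ⟹ σ-door), §3 (rows), §4 (sheaf corner). NO door
assumption is taken by name at the gluable class. NOT here: any object or σ-rank; tier words; re-typing of `sigmaAdmissible` /
`rankAdmissible`; HC_CM, CM density, Mumford–Tate finiteness. -/

end Summit.Ventures.HSemireg

end
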